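import Summits.QuantumFields.BalabanUV.T4Continuum.Spine.NE1p.DressedSmallFieldAllowance

/-!
# T⁴ programme, spine estimate NE1′ (node O3b/H2) — WITNESS «THE THIRD RADIUS IS NOT FOR SALE»: the owner's window estimate
# `DressedSmallFieldAllowance.muDeriv_norm_le_of_window` (`‖∂E(μ)‖ ≤ 2M∕(μ₁ − μ₀)` on `‖μ‖ ≤ μ₀ < μ₁`, C-t4r2-340 (n2) «termwise
# μ-differentiation needs a third radius») FIRES on the scaled disc automorphism `z ↦ M·μ₁·(z − μ₀)∕(μ₁² − μ₀ z)` — a datum bounded by `M`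
# on the `μ₁`-disc whose response AT the window point is EXACTLY `M·μ₁∕((μ₁ − μ₀)(μ₁ + μ₀)) ≥ M∕(2(μ₁ − μ₀))`: the estimate is met within
# the factor `4`, the `(μ₁ − μ₀)⁻¹` blow-up is ATTAINED, and NO window-free response constant `C·M∕μ₁` exists

Cell `pub-balaban`, sub-cell `t4`, BINDER-OWNERS row NE1′; NE1′ formalisation crew, unit `b2b-balaban-t4-ne1p-formalise-leaf-06`
(LEAF PROVER 06, generation 14); crew row W102 ∕ DAG N29zzzzzq of `t4/formal/NE1p/LEAVES.md` (BOOKED typer R-T155 `HOME/CLAIMS.log`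
l.25364 on INTENT l.25152; LANDED p245020 l.25304; cross-read X247 ok (leaf-08-g14);
a (t7)-style SEPARATION record for the owner's N0g §2, in the line of this unit's W4s `DressedRootStrictSeparation` «the rate parameter is
content» and of the g4 cross-read X93's INFO-2 «Schwarz factor 2 not sharp but `M∕ε` false in general (disc automorphism)», now in kernel).
ADDITIVE — imports the owner's N0g `Spine/NE1p/DressedSmallFieldAllowance` (p218876) ONLY; THEOREMS ONLY (the automorphism is written
out as a lambda in every statement — 0 def, 0 `def … : Prop`, 0 cite); nothing of N0g restated — `muDeriv_norm_le_of_window` is APPLIED ONCE BY NAME (§3) to the extremal datum.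

WHY THIS FILE.  Every response face of the crew (N0j `muDeriv_locE_le…`, S33 ∕ S37 ∕ S46 ∕ S50, S61 and its appliers W92 ∕ «the response
at the cores», W98's third radius for the (1.23) letter) carries the window quotient `(μ₁ − μ₀)⁻¹` of N0g §2, and t4-ref2's precision note
(n2) records that the (w6) window must be a STRICT sub-window of the μ-analyticity disc.  Whether that quotient is an artefact of the Cauchy
estimate or a genuine price was decided nowhere in the tree (`grep -rn "μ₁ ^ 2 - μ₀" Spine/NE1p` = ∅).  Here, by the textbook extremal:
* §1 [folklore] the datum `z ↦ M·μ₁·(z − μ₀)∕(μ₁² − μ₀ z)` (a lambda, «mob» in prose); `denom_ne_zero` on `‖z‖ < μ₁` (`0 ≤ μ₀ < μ₁`); the PICK IDENTITY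
  `normSq_identity`: `|μ₁² − μ₀ z|² − μ₁²|z − μ₀|² = (μ₁² − |z|²)(μ₁² − μ₀²)`; hence `norm_mob_le`: `‖mob z‖ ≤ M` on the disc.
* §2 [folklore] `hasDerivAt_mob` (quotient rule: `∂ mob = M·μ₁·(μ₁² − μ₀²)∕(μ₁² − μ₀ z)²`), `differentiableOn_mob`, `deriv_mob_at_window`
  (`= M·μ₁∕(μ₁² − μ₀²)`, real), `norm_deriv_mob_at_window` (`= M·μ₁∕((μ₁ − μ₀)(μ₁ + μ₀))`).
* §3 `window_estimate_sandwich` (kernel; N0g §2 EXACTLY ONCE BY NAME on the datum): `M∕(2(μ₁ − μ₀)) ≤ ‖∂ mob(μ₀)‖ ≤ 2M∕(μ₁ − μ₀)` — the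
  owner's END is inhabited by a datum on which it is sharp within the factor `4`; `no_windowFree_bound`: there is NO `C` with
  `‖∂E(μ)‖ ≤ C·M∕μ₁` for all `E` holomorphic and `M`-bounded on a `μ₁`-disc and all `‖μ‖ ≤ μ₀ < μ₁` (witness `mob` at `μ₁ = M = 1`,
  `μ₀ = 1 − 1∕(4(|C| + 1))`); closing `example`: at `(M, μ₁, μ₀) = (1, 1, ½)` the response is `4∕3` — under the owner's `4`, over the window-free `1`.

HONEST FRAMING.  Textbook one-variable complex analysis ([folklore]: a Möbius map of the disc, the Pick identity by `ring` on real and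
imaginary parts, the quotient rule); a statement about the SHAPE of the owner's [folklore] Cauchy estimate — which (n2) asks the PAY∕allowance
record to carry — namely that its window quotient cannot be removed by a better proof; NOT a statement about Bałaban's densities, (2.14)–(2.15),
or any printed constant.  OWNER's RIDER (g41, `HOME/CLAIMS.log`, verbatim): «a statement about the SHAPE of a [folklore] estimate for ARBITRARY
`M`-bounded holomorphic `E` on the `μ₁`-disc — it shows the third radius (C-t4r2-340 (n2)) is NECESSARY IN KIND for window-type bounds of that
generality; it does NOT show that Bałaban's dressed activities saturate it (print's small-field output carries more structure than
`M`-boundedness — per-term (2.14)∕(2.20) data — so a window-free response bound for THEM is neither asserted nor excluded here); (w6)'s window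
and (n2) stand as displayed bookkeeping; (B1)∕(B3)∕(B5) and the wall untouched».  The (w6) window, `C₃`, Lemma 3's list NOT touched;
(B1) ∕ (B3) ∕ (B5) NOT discharged; 0 binders instantiated on Bałaban's densities; no wall item; the NE1′ wall wording of record v1.8 (T4-DAG v48) —
words, not kind — does NOT move; R-t4r2-Q2 NOT met; ABSOLUTE RULE honoured (no numeral of print; nothing internally minted is cited).  NE1′ ⇐ the
named binders — NOT proved, NOT printed; spine PROVED 0∕9; count 9 unchanged.  Rung (B)+1 on ONE finite four-torus — NOT infinite volume, NOT a mass
gap, NOT OS on ℝ⁴, NOT Clay.  HONEST DEPENDENCY: continuum YM on T⁴ ⇐ BetaPertH ∧ nine spine estimates (0/9 proved); BetaPertH ⇐ (D1) ∧ (D4) ∧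
CAP+tail; G-an2-4 gates asym, D1 and NE2/3/4.
-/

noncomputable section

namespace Summit.QuantumFields.BalabanUV.T4Continuum.NE1p.DressedMuWindowSharpnessWitness

open Metric Set Complex
open Summit.QuantumFields.BalabanUV.T4Continuum.NE1p.DressedSmallFieldAllowance (muDeriv_norm_le_of_window)

/-! ## §1 The extremal datum: a scaled automorphism of the `μ₁`-disc -/

/-! THE DATUM (written out as a lambda in every statement — THEOREMS ONLY, no `def`): the scaled disc automorphism of the `μ₁`-disc
moving the real window point `μ₀` to `0`, `mob(z) = M·μ₁·(z − μ₀)∕(μ₁² − μ₀·z)`. -/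

variable {M μ₁ μ₀ : ℝ}

/-- The denominator does not vanish on the disc `‖z‖ < μ₁` when `0 ≤ μ₀ < μ₁`. [folklore] -/
theorem denom_ne_zero (h0 : 0 ≤ μ₀) (h01 : μ₀ < μ₁) {z : ℂ} (hz : ‖z‖ < μ₁) : ((μ₁ : ℂ) ^ 2 - μ₀ * z) ≠ 0 := by
  intro h
  have hμ₁ : 0 < μ₁ := lt_of_le_of_lt h0 h01
  have h1 : ‖(μ₀ : ℂ) * z‖ < μ₁ ^ 2 := by
    rw [norm_mul, Complex.norm_real, Real.norm_eq_abs, abs_of_nonneg h0]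
    calc μ₀ * ‖z‖ ≤ μ₀ * μ₁ := mul_le_mul_of_nonneg_left hz.le h0
      _ < μ₁ * μ₁ := mul_lt_mul_of_pos_right h01 hμ₁
      _ = μ₁ ^ 2 := by ring
  have h2 : ((μ₁ : ℂ) ^ 2) = μ₀ * z := sub_eq_zero.1 h
  have h3 : ‖((μ₁ : ℂ) ^ 2)‖ = μ₁ ^ 2 := by
    rw [norm_pow, Complex.norm_real, Real.norm_eq_abs, abs_of_pos hμ₁]
  rw [h2] at h3
  linarith

/-- [folklore] THE PICK IDENTITY behind the bound: `|μ₁² − μ₀ z|² − μ₁²·|z − μ₀|² = (μ₁² − |z|²)·(μ₁² − μ₀²)`. -/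
theorem normSq_identity (z : ℂ) :
    Complex.normSq ((μ₁ : ℂ) ^ 2 - μ₀ * z) - μ₁ ^ 2 * Complex.normSq (z - μ₀) =
      (μ₁ ^ 2 - Complex.normSq z) * (μ₁ ^ 2 - μ₀ ^ 2) := by
  rw [Complex.normSq_apply, Complex.normSq_apply, Complex.normSq_apply]
  simp only [Complex.sub_re, Complex.sub_im, Complex.mul_re, Complex.mul_im, Complex.ofReal_re, Complex.ofReal_im,
    zero_mul, sub_zero, add_zero]
  have hre : (((μ₁ : ℂ) ^ 2).re) = μ₁ ^ 2 := by rw [← Complex.ofReal_pow]; exact Complex.ofReal_re _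
  have him : (((μ₁ : ℂ) ^ 2).im) = 0 := by rw [← Complex.ofReal_pow]; exact Complex.ofReal_im _
  rw [hre, him]
  ring

/-- **THE AUTOMORPHISM STAYS IN THE `M`-BALL** [folklore]: for `0 ≤ μ₀ < μ₁`, `0 ≤ M` and `‖z‖ < μ₁`, `‖mob M μ₁ μ₀ z‖ ≤ M`. -/
theorem norm_mob_le (hM : 0 ≤ M) (h0 : 0 ≤ μ₀) (h01 : μ₀ < μ₁) {z : ℂ} (hz : ‖z‖ < μ₁) : ‖(fun z : ℂ => (M : ℂ) * μ₁ * (z - μ₀) / ((μ₁ : ℂ) ^ 2 - μ₀ * z)) z‖ ≤ M := by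
  have hμ₁ : 0 < μ₁ := lt_of_le_of_lt h0 h01
  have hden := denom_ne_zero h0 h01 hz
  have hdenpos : 0 < ‖((μ₁ : ℂ) ^ 2 - μ₀ * z)‖ := norm_pos_iff.2 hden
  rw [norm_div, norm_mul, norm_mul, Complex.norm_real, Complex.norm_real, Real.norm_eq_abs, Real.norm_eq_abs,
    abs_of_nonneg hM, abs_of_pos hμ₁, div_le_iff₀ hdenpos]
  -- `M·μ₁·|z − μ₀| ≤ M·|μ₁² − μ₀ z|` from the Pick identity
  have hkey : μ₁ * ‖z - (μ₀ : ℂ)‖ ≤ ‖((μ₁ : ℂ) ^ 2 - μ₀ * z)‖ := by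
    have hsq : (μ₁ * ‖z - (μ₀ : ℂ)‖) ^ 2 ≤ ‖((μ₁ : ℂ) ^ 2 - μ₀ * z)‖ ^ 2 := by
      rw [mul_pow, Complex.sq_norm, Complex.sq_norm]
      have hid := normSq_identity (μ₁ := μ₁) (μ₀ := μ₀) z
      have hz2 : Complex.normSq z < μ₁ ^ 2 := by
        rw [Complex.normSq_eq_norm_sq]; exact pow_lt_pow_left₀ hz (norm_nonneg _) two_ne_zero
      have hμ2 : μ₀ ^ 2 < μ₁ ^ 2 := pow_lt_pow_left₀ h01 h0 two_ne_zero
      nlinarith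
    exact (pow_le_pow_iff_left₀ (mul_nonneg hμ₁.le (norm_nonneg _)) (norm_nonneg _) two_ne_zero).1 hsq
  calc M * μ₁ * ‖z - (μ₀ : ℂ)‖ = M * (μ₁ * ‖z - (μ₀ : ℂ)‖) := by ring
    _ ≤ M * ‖((μ₁ : ℂ) ^ 2 - μ₀ * z)‖ := mul_le_mul_of_nonneg_left hkey hM

/-! ## §2 Its response -/

/-- **THE DERIVATIVE OF THE AUTOMORPHISM** [folklore]: at every `‖z‖ < μ₁`,
`∂_z mob = M·μ₁·(μ₁² − μ₀²)∕(μ₁² − μ₀ z)²` (quotient rule). -/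
theorem hasDerivAt_mob (h0 : 0 ≤ μ₀) (h01 : μ₀ < μ₁) {z : ℂ} (hz : ‖z‖ < μ₁) :
    HasDerivAt (fun z : ℂ => (M : ℂ) * μ₁ * (z - μ₀) / ((μ₁ : ℂ) ^ 2 - μ₀ * z))
      ((M : ℂ) * μ₁ * ((μ₁ : ℂ) ^ 2 - (μ₀ : ℂ) ^ 2) / ((μ₁ : ℂ) ^ 2 - μ₀ * z) ^ 2) z := by
  have hden := denom_ne_zero h0 h01 hz
  have hnum : HasDerivAt (fun z : ℂ => (M : ℂ) * μ₁ * (z - μ₀)) ((M : ℂ) * μ₁ * 1) z :=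
    ((hasDerivAt_id z).sub_const (μ₀ : ℂ)).const_mul ((M : ℂ) * μ₁)
  have hd : HasDerivAt (fun z : ℂ => (μ₁ : ℂ) ^ 2 - μ₀ * z) (0 - (μ₀ : ℂ) * 1) z :=
    (hasDerivAt_const z ((μ₁ : ℂ) ^ 2)).sub ((hasDerivAt_id z).const_mul (μ₀ : ℂ))
  have h := hnum.div hd hden
  beta_reduce at h
  refine h.congr_deriv ?_
  ring

/-- The automorphism is holomorphic on the `μ₁`-disc. [folklore] -/
theorem differentiableOn_mob (h0 : 0 ≤ μ₀) (h01 : μ₀ < μ₁) :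
    DifferentiableOn ℂ (fun z : ℂ => (M : ℂ) * μ₁ * (z - μ₀) / ((μ₁ : ℂ) ^ 2 - μ₀ * z)) (ball (0 : ℂ) μ₁) :=
  fun _ hz => (hasDerivAt_mob (M := M) h0 h01 (mem_ball_zero_iff.1 hz)).differentiableAt.differentiableWithinAt

/-- **ITS DERIVATIVE AT THE WINDOW POINT** [folklore]: `∂_z mob (μ₀) = M·μ₁∕(μ₁² − μ₀²)` — real, and for `0 ≤ M` of norm
`M·μ₁∕((μ₁ − μ₀)(μ₁ + μ₀))`. -/
theorem deriv_mob_at_window (h0 : 0 ≤ μ₀) (h01 : μ₀ < μ₁) :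
    deriv (fun z : ℂ => (M : ℂ) * μ₁ * (z - μ₀) / ((μ₁ : ℂ) ^ 2 - μ₀ * z)) (μ₀ : ℂ) =
      (((M * μ₁ / (μ₁ ^ 2 - μ₀ ^ 2) : ℝ)) : ℂ) := by
  have hz : ‖(μ₀ : ℂ)‖ < μ₁ := by rw [Complex.norm_real, Real.norm_eq_abs, abs_of_nonneg h0]; exact h01
  rw [(hasDerivAt_mob (M := M) h0 h01 hz).deriv]
  have hμ2 : μ₀ ^ 2 < μ₁ ^ 2 := pow_lt_pow_left₀ h01 h0 two_ne_zero
  have hne : ((μ₁ : ℂ) ^ 2 - (μ₀ : ℂ) ^ 2) ≠ 0 := by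
    rw [← Complex.ofReal_pow, ← Complex.ofReal_pow, ← Complex.ofReal_sub, Complex.ofReal_ne_zero]; exact (sub_pos.2 hμ2).ne'
  have hden : ((μ₁ : ℂ) ^ 2 - μ₀ * μ₀) = ((μ₁ : ℂ) ^ 2 - (μ₀ : ℂ) ^ 2) := by ring
  rw [hden, pow_two ((μ₁ : ℂ) ^ 2 - (μ₀ : ℂ) ^ 2), mul_div_mul_comm, div_self hne, mul_one]
  push_cast
  ring

/-- … of norm `M·μ₁∕((μ₁ − μ₀)(μ₁ + μ₀))` for `0 ≤ M`. [folklore] -/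
theorem norm_deriv_mob_at_window (hM : 0 ≤ M) (h0 : 0 ≤ μ₀) (h01 : μ₀ < μ₁) :
    ‖deriv (fun z : ℂ => (M : ℂ) * μ₁ * (z - μ₀) / ((μ₁ : ℂ) ^ 2 - μ₀ * z)) (μ₀ : ℂ)‖ = M * μ₁ / ((μ₁ - μ₀) * (μ₁ + μ₀)) := by
  rw [deriv_mob_at_window h0 h01, Complex.norm_real, Real.norm_eq_abs, show μ₁ ^ 2 - μ₀ ^ 2 = (μ₁ - μ₀) * (μ₁ + μ₀) by ring]
  have hμ₁ : 0 < μ₁ := lt_of_le_of_lt h0 h01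
  exact abs_of_nonneg (div_nonneg (mul_nonneg hM hμ₁.le) (mul_nonneg (sub_pos.2 h01).le (by linarith)))

/-! ## §3 The owner's window estimate FIRES on the datum and is met within the factor 4; no window-free constant -/

/-- **THE OWNER'S WINDOW ESTIMATE IS MET WITHIN THE FACTOR 4 — THE `(μ₁ − μ₀)⁻¹` BLOW-UP IS ATTAINED** [folklore]: for `0 ≤ M`,
`0 ≤ μ₀ < μ₁`, the datum `mob` is holomorphic on the `μ₁`-disc and bounded by `M` there (so N0g §2 `muDeriv_norm_le_of_window` FIRES:
`‖∂ mob(μ₀)‖ ≤ 2M∕(μ₁ − μ₀)`), AND `‖∂ mob(μ₀)‖ = M·μ₁∕((μ₁ − μ₀)(μ₁ + μ₀)) ≥ M∕(2(μ₁ − μ₀))`. -/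
theorem window_estimate_sandwich (hM : 0 ≤ M) (h0 : 0 ≤ μ₀) (h01 : μ₀ < μ₁) :
    M / (2 * (μ₁ - μ₀)) ≤ ‖deriv (fun z : ℂ => (M : ℂ) * μ₁ * (z - μ₀) / ((μ₁ : ℂ) ^ 2 - μ₀ * z)) (μ₀ : ℂ)‖ ∧
      ‖deriv (fun z : ℂ => (M : ℂ) * μ₁ * (z - μ₀) / ((μ₁ : ℂ) ^ 2 - μ₀ * z)) (μ₀ : ℂ)‖ ≤ 2 * M / (μ₁ - μ₀) := by
  refine ⟨?_, muDeriv_norm_le_of_window (differentiableOn_mob h0 h01) (fun z hz => norm_mob_le hM h0 h01 (mem_ball_zero_iff.1 hz)) h01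
    (by rw [Complex.norm_real, Real.norm_eq_abs, abs_of_nonneg h0])⟩
  rw [norm_deriv_mob_at_window hM h0 h01]
  have hμ₁ : 0 < μ₁ := lt_of_le_of_lt h0 h01
  have hgap : 0 < μ₁ - μ₀ := sub_pos.2 h01
  rw [div_le_div_iff₀ (by positivity) (by positivity)]
  have h1 : (μ₁ - μ₀) * (μ₁ + μ₀) ≤ (μ₁ - μ₀) * (2 * μ₁) := mul_le_mul_of_nonneg_left (by linarith) hgap.le
  calc M * ((μ₁ - μ₀) * (μ₁ + μ₀)) ≤ M * ((μ₁ - μ₀) * (2 * μ₁)) := mul_le_mul_of_nonneg_left h1 hM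
    _ = M * μ₁ * (2 * (μ₁ - μ₀)) := by ring

/-- **NO WINDOW-FREE RESPONSE CONSTANT EXISTS** [folklore]: there is NO `C` such that every `E` holomorphic on a disc `‖z‖ < μ₁` and
bounded by `M` there has `‖∂E(μ)‖ ≤ C·M∕μ₁` at every `‖μ‖ ≤ μ₀ < μ₁` — the strict sub-window's quotient `(μ₁ − μ₀)⁻¹` of
C-t4r2-340 (n2) is NECESSARY (witness: `mob` at `μ₁ = M = 1`, `μ₀ = 1 − 1∕(4(|C| + 1))`). -/
theorem no_windowFree_bound :
    ¬ ∃ C : ℝ, ∀ (E : ℂ → ℂ) (M μ₁ μ₀ : ℝ) (μ : ℂ), 0 < μ₁ → DifferentiableOn ℂ E (ball (0 : ℂ) μ₁) →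
      (∀ z ∈ ball (0 : ℂ) μ₁, ‖E z‖ ≤ M) → μ₀ < μ₁ → ‖μ‖ ≤ μ₀ → ‖deriv E μ‖ ≤ C * M / μ₁ := by
  rintro ⟨C, hC⟩
  have hc1 : 0 < |C| + 1 := by positivity
  set μ₀ : ℝ := 1 - 1 / (4 * (|C| + 1)) with hμ₀
  have hq : 0 < 1 / (4 * (|C| + 1)) := by positivity
  have hq' : 1 / (4 * (|C| + 1)) ≤ 1 / 4 := by
    rw [div_le_div_iff₀ (by positivity) (by norm_num)]; nlinarith [abs_nonneg C]
  have h0 : 0 ≤ μ₀ := by rw [hμ₀]; linarith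
  have h01 : μ₀ < 1 := by rw [hμ₀]; linarith
  have hlow := (window_estimate_sandwich (M := 1) zero_le_one h0 h01).1
  have hup := hC (fun z : ℂ => ((1 : ℝ) : ℂ) * (1 : ℝ) * (z - μ₀) / (((1 : ℝ) : ℂ) ^ 2 - μ₀ * z)) 1 1 μ₀ (μ₀ : ℂ) one_pos
    (differentiableOn_mob (M := 1) h0 h01) (fun z hz => norm_mob_le zero_le_one h0 h01 (mem_ball_zero_iff.1 hz)) h01
    (by rw [Complex.norm_real, Real.norm_eq_abs, abs_of_nonneg h0])
  have hgap : 1 - μ₀ = 1 / (4 * (|C| + 1)) := by rw [hμ₀]; ring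
  rw [hgap] at hlow
  have hval : (1 : ℝ) / (2 * (1 / (4 * (|C| + 1)))) = 2 * (|C| + 1) := by field_simp; ring
  rw [hval] at hlow
  have hCle : C ≤ |C| := le_abs_self C
  have : C * 1 / 1 = C := by ring
  rw [this] at hup
  linarith

/-- **DECIDED**: at `M = 1`, `μ₁ = 1`, `μ₀ = ½` the automorphism's response is `1·1∕((1 − ½)(1 + ½)) = 4∕3` — inside the owner's window
bound `2∕(1 − ½) = 4` and above the window-free guess `1`. [located] -/
example : ‖deriv (fun z : ℂ => (((1 : ℝ)) : ℂ) * ((1 : ℝ) : ℂ) * (z - ((1 / 2 : ℝ) : ℂ)) / ((((1 : ℝ)) : ℂ) ^ 2 - ((1 / 2 : ℝ) : ℂ) * z))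
      (((1 / 2 : ℝ)) : ℂ)‖ = 4 / 3 ∧ (4 / 3 : ℝ) ≤ 2 * 1 / (1 - 1 / 2) ∧ (1 : ℝ) < 4 / 3 := by
  refine ⟨?_, by norm_num, by norm_num⟩
  rw [norm_deriv_mob_at_window (M := 1) zero_le_one (by norm_num) (by norm_num)]
  norm_num

end Summit.QuantumFields.BalabanUV.T4Continuum.NE1p.DressedMuWindowSharpnessWitness

end
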